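import Literature.AlgebraicGeometry.ShimuraVarieties.UnitaryAuxiliaryTorusDatum
import Literature.NumberTheory.NumberFields.IdelicArtinMapRestriction
import HarnessLib

/-!
# Norm functoriality of the Artin correspondence `σ ↔ s` down a tower of number fields
# (`art_L ∘ N_{k/L} = res ∘ art_k`, [Milne2005ShimuraVarieties] (59); Cassels–Fröhlich VII Prop. 4.3)

Topic `AlgebraicGeometry/ShimuraVarieties`; namespace
`Literature.AlgebraicGeometry.ShimuraVarieties.UnitaryCanonicalModel` (general tower) and `….Aux` (the reflex
tower `τL ⊆ E♯` of the auxiliary datum of `UnitaryAuxiliaryTorusDatum`).  THEOREMS ONLY (no definition, no named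
fact, no instance; D-0014).  Cell hodgecm-mathlib, fan B, rung B-I, KEY `b1-artin-norm-functorial` (skeleton
`B1HeckeQuotientDescent` v7 §8, support stub (b′, T⁺) `stub_artinNormFunctorial : StubArtinNormFunctorial`).  HC_CM
is proved only modulo the 7 printed citations until rung 0 closes; nothing here changes that.

## The statements

* `UnitaryCanonicalModel.IsArtinCorrespondent.finiteIdeleRelNorm` (GENERAL TOWER): let `L → k` be a tower of number
  fields (`[Algebra L k]`) with embeddings `τ : L → ℂ`, `ι : k → ℂ` such that `ι ∘ (L → k) = τ`.  If a finite idèle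
  `s` of `k` is an Artin correspondent of `σ ∈ Aut(ℂ)` along `ι`
  (`UnitaryCanonicalModel.IsArtinCorrespondent k ι s σ`: `σ|_{k̄} = γ` along some `k`-embedding `e : k̄ → ℂ` with
  `[γ] = θ_k((1_∞, s))⁻¹` in `Gal(k̄/k)^ab`, [Milne2005ShimuraVarieties] (59)), then `N_{k/L} s`
  (`AdelicBaseChange.finiteIdeleRelNorm L k s`) is an Artin correspondent of the SAME `σ` along `τ`.
* `UnitaryCanonicalModel.Aux.isArtinCorrespondent_finiteIdeleRelNorm` (THE STUB VERBATIM): the case `k = E♯ :=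
  Aux.reflexField L Φ τ ⊂ ℂ`, `ι` the inclusion, `L → E♯` the map `Aux.toReflexField L Φ τ` (= `τ`), with the
  instances `Aux.numberField_reflexField`, `(Aux.toReflexField L Φ τ).toAlgebra` exactly as in the skeleton.

## Proof

* EMBEDDINGS: `e' := e ∘ ι̂` with `ι̂ = absClosureEmbedding L k : L̄ → k̄` the tree's fixed `L`-embedding (an
  `L`-algebra map `L̄ → ℂ` for `τ.toAlgebra` because `ι ∘ (L → k) = τ`), and `γ' := res γ = absGaloisRestrict L k γ`,
  for which `ι̂ (res γ · x) = γ · ι̂ x` (`absGaloisRestrict_apply_smul`); hence `e' ∘ γ' = σ ∘ e'`.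
* ARTIN/NORM: in `Γ_L^ab`, `[res γ] = res^ab [γ] = res^ab θ_k((1_∞, s))⁻¹` (`absGaloisRestrictAb_mk`), and
  `res^ab θ_k((1_∞, s)) = θ_L(N_{k/L}(1_∞, s))` is THE ARTIN MAP COMMUTES WITH RESTRICTION AND NORM
  (`NumberFields.absGaloisRestrictAb_ideleArtinMap`, Tate VII Prop. 4.3 in the limit), while
  `N_{k/L}(1_∞, s) = (1_∞, N_{k/L} s)` EXACTLY (`ideleRelNorm_map_inr`: the idèle norm is componentwise,
  `AdelicBaseChange.fst_adeleRelNorm` / `snd_adeleRelNorm`, and `N(1_∞) = 1_∞`) — no totally-complex hypothesis is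
  needed.

## References
* [Milne2005ShimuraVarieties] J. S. Milne, *Introduction to Shimura varieties* (2005), (59) p. 107 (functoriality
  of `art`).
* [Shimura1998] G. Shimura, *Abelian Varieties with Complex Multiplication and Modular Functions* (1998), §18.3
  pp. 121–122.
* [CasselsFrohlichANT1967] J. W. S. Cassels, A. Fröhlich (eds.), *Algebraic Number Theory* (1967): Ch. II §19
  (19.15)–(19.17); Ch. VII (Tate) §4 Prop. 4.3.
-/

set_option autoImplicit false

noncomputable section

open Function NumberField Field IsDedekindDomain
open Literature.AlgebraicGeometry.Motives
open Literature.NumberTheory.GaloisRepresentations Literature.NumberTheory.NumberFields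
open Literature.NumberTheory.AdelicBaseChange (finiteIdeleRelNorm finiteAdeleRelNorm infiniteAdeleRelNorm
  ideleRelNorm coe_finiteIdeleRelNorm coe_ideleRelNorm fst_adeleRelNorm snd_adeleRelNorm)

namespace Literature.AlgebraicGeometry.ShimuraVarieties

namespace UnitaryCanonicalModel

/-! ### §1. Norm bookkeeping on a tower `L → k`: `N_{k/L}(1_∞, s) = (1_∞, N_{k/L} s)` -/

section Tower

variable (L k : Type) [Field L] [NumberField L] [Field k] [NumberField k] [Algebra L k]

/-- **`N_{k/L}(1_∞, s) = (1_∞, N_{k/L} s)`**: the idèle norm of the idèle `(1_∞, s)` of a finite idèle `s` of `k`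
is the idèle `(1_∞, N_{k/L} s)` of `L` — the adèle norm is componentwise archimedean / non-archimedean
(`fst_adeleRelNorm`, `snd_adeleRelNorm`) and `N(1_∞) = 1_∞`.
[cite: CasselsFrohlichANT1967, Ch. II §19 (19.15)–(19.17)] -/
theorem ideleRelNorm_map_inr (s : (FiniteAdeleRing (𝓞 k) k)ˣ) :
    ideleRelNorm L k
        (Units.map (MonoidHom.inr (InfiniteAdeleRing k) (FiniteAdeleRing (𝓞 k) k) :
          FiniteAdeleRing (𝓞 k) k →* AdeleRing (𝓞 k) k) s) =
      Units.map (MonoidHom.inr (InfiniteAdeleRing L) (FiniteAdeleRing (𝓞 L) L) :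
          FiniteAdeleRing (𝓞 L) L →* AdeleRing (𝓞 L) L) (finiteIdeleRelNorm L k s) := by
  refine Units.ext (Prod.ext ?_ ?_)
  · rw [coe_ideleRelNorm, Units.coe_map, Units.coe_map, MonoidHom.inr_apply, MonoidHom.inr_apply,
      fst_adeleRelNorm, map_one]
  · rw [coe_ideleRelNorm, Units.coe_map, Units.coe_map, MonoidHom.inr_apply, MonoidHom.inr_apply,
      snd_adeleRelNorm, coe_finiteIdeleRelNorm]

/-- The finite idèle class of `N_{k/L} s` is the class of the idèle norm `N_{k/L}(1_∞, s)`.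
[cite: CasselsFrohlichANT1967, Ch. II §19 (19.15)–(19.17)] -/
theorem finiteIdeleClass_finiteIdeleRelNorm (s : (FiniteAdeleRing (𝓞 k) k)ˣ) :
    finiteIdeleClass L (finiteIdeleRelNorm L k s) =
      QuotientGroup.mk (ideleRelNorm L k
        (Units.map (MonoidHom.inr (InfiniteAdeleRing k) (FiniteAdeleRing (𝓞 k) k) :
          FiniteAdeleRing (𝓞 k) k →* AdeleRing (𝓞 k) k) s)) := by
  rw [ideleRelNorm_map_inr]
  rfl

/-- **`θ_L((1_∞, N_{k/L} s)) = res^ab θ_k((1_∞, s))`** — the universal norm-residue symbols of the tower commute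
with restriction `Γ_k^ab → Γ_L^ab` and norm (`NumberFields.absGaloisRestrictAb_ideleArtinMap`, Tate VII Prop. 4.3
in the limit), read on the finite idèle classes of `UnitaryCanonicalModel.finiteIdeleClass`.
[cite: CasselsFrohlichANT1967, Ch. VII §4 Prop. 4.3 (PDF p. 212) and §5.4–5.6]
[cite: Milne2005ShimuraVarieties, (59) p. 107] -/
theorem theta_finiteIdeleClass_finiteIdeleRelNorm (s : (FiniteAdeleRing (𝓞 k) k)ˣ) :
    (isGlobalReciprocitySystem_artinMap L).theta (finiteIdeleClass L (finiteIdeleRelNorm L k s)) =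
      absGaloisRestrictAb L k ((isGlobalReciprocitySystem_artinMap k).theta (finiteIdeleClass k s)) := by
  rw [finiteIdeleClass_finiteIdeleRelNorm, finiteIdeleClass, ← ideleArtinMap_apply, ← ideleArtinMap_apply,
    absGaloisRestrictAb_ideleArtinMap]

variable {L k} in
/-- **`[res γ] = θ_L((1_∞, N_{k/L} s))⁻¹` when `[γ] = θ_k((1_∞, s))⁻¹`**: the Artin relation of
[Milne2005ShimuraVarieties] (59) (`art = rec⁻¹`) descends along the restriction `res : Γ_k → Γ_L`
(`absGaloisRestrict`) with `s ↦ N_{k/L} s`. [cite: Milne2005ShimuraVarieties, (59) p. 107]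
[cite: CasselsFrohlichANT1967, Ch. VII §4 Prop. 4.3] -/
theorem absGaloisAbProj_absGaloisRestrict_eq_theta_inv {γ : absoluteGaloisGroup k}
    {s : (FiniteAdeleRing (𝓞 k) k)ˣ}
    (hγ : absGaloisAbProj k γ = ((isGlobalReciprocitySystem_artinMap k).theta (finiteIdeleClass k s))⁻¹) :
    absGaloisAbProj L (absGaloisRestrict L k γ) =
      ((isGlobalReciprocitySystem_artinMap L).theta (finiteIdeleClass L (finiteIdeleRelNorm L k s)))⁻¹ := by
  rw [← absGaloisRestrictAb_mk, hγ, map_inv, theta_finiteIdeleClass_finiteIdeleRelNorm]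

/-! ### §2. The general tower theorem -/

variable {L k} in
/-- **Norm functoriality of the Artin correspondence (general tower).**  Let `L → k` be a tower of number fields
with embeddings `τ : L → ℂ`, `ι : k → ℂ`, `ι ∘ (L → k) = τ`.  If the finite idèle `s` of `k` is an Artin
correspondent of `σ ∈ Aut(ℂ)` along `ι` ([Milne2005ShimuraVarieties] (59): `art_k(s) = σ|k^ab`), then `N_{k/L} s`
is an Artin correspondent of the same `σ` along `τ` (`art_L(N_{k/L} s) = σ|L^ab`): restrict the witness `(e, γ)`
along the tree's embedding `ι̂ = absClosureEmbedding L k : L̄ → k̄` (`e ∘ ι̂`, `res γ` with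
`ι̂ (res γ · x) = γ · ι̂ x`, `absGaloisRestrict_apply_smul`) and use `res^ab ∘ θ_k = θ_L ∘ N_{k/L}`
(`absGaloisAbProj_absGaloisRestrict_eq_theta_inv`).  [Shimura1998] §18.3: «`[N_{k/L} y, L]` = the restriction
of `[y, k]`». [cite: Milne2005ShimuraVarieties, (59) p. 107] [cite: Shimura1998, §18.3 pp. 121–122]
[cite: CasselsFrohlichANT1967, Ch. VII §4 Prop. 4.3] -/
theorem IsArtinCorrespondent.finiteIdeleRelNorm {τ : L →+* ℂ} {ι : k →+* ℂ}
    (hι : ∀ x : L, ι (algebraMap L k x) = τ x) {s : (FiniteAdeleRing (𝓞 k) k)ˣ} {σ : ℂ ≃+* ℂ}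
    (h : IsArtinCorrespondent k ι s σ) :
    IsArtinCorrespondent L τ (finiteIdeleRelNorm L k s) σ := by
  letI : Algebra k ℂ := ι.toAlgebra
  obtain ⟨e, γ, he, hγ⟩ := h
  letI : Algebra L ℂ := τ.toAlgebra
  -- `e' := e ∘ ι̂`, an `L`-embedding `L̄ → ℂ` along `τ`
  let e' : AlgebraicClosure L →ₐ[L] ℂ :=
    { toRingHom := e.toRingHom.comp (absClosureEmbedding L k).toRingHom
      commutes' := by
        intro x
        change e (absClosureEmbedding L k (algebraMap L (AlgebraicClosure L) x)) = τ x
        rw [AlgHom.commutes, IsScalarTower.algebraMap_apply L k (AlgebraicClosure k), AlgHom.commutes]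
        exact hι x }
  refine ⟨e', absGaloisRestrict L k γ, fun x => ?_, absGaloisAbProj_absGaloisRestrict_eq_theta_inv hγ⟩
  -- `e (ι̂ (res γ · x)) = e (γ · ι̂ x) = σ (e (ι̂ x))`
  change e (absClosureEmbedding L k (absGaloisRestrict L k γ • x)) = σ (e (absClosureEmbedding L k x))
  rw [absGaloisRestrict_apply_smul, Field.absoluteGaloisGroup.smul_def, he]

end Tower

/-! ### §3. The support stub (b′, T⁺): the reflex tower `τL ⊆ E♯` -/

namespace Aux

/-- **Support stub (b′, T⁺) — norm functoriality of the Artin correspondence down the tower `τL ⊆ E♯`**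
(`E♯ = Aux.reflexField L Φ τ ⊂ ℂ`, an `L`-algebra through `Aux.toReflexField L Φ τ`, so
`algebraMap ↥E♯ ℂ ∘ toReflexField = τ`): if the finite idèle `s♯` of `E♯` is an Artin correspondent of `σ ∈ Aut(ℂ)`
over `E♯ ⊂ ℂ`, then `N_{E♯/L}(s♯)` is an Artin correspondent of the SAME `σ` over `(L, τ)` —
`art_L ∘ N_{E♯/L} = res ∘ art_{E♯}` ([Milne2005ShimuraVarieties] (59) functoriality; [Shimura1998] §18.3; the
tree's `absGaloisRestrictAb_ideleArtinMap`).  The statement is VERBATIM the skeleton's `StubArtinNormFunctorial`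
(instances `numberField_reflexField`, `toReflexField.toAlgebra`); it is the case `k = E♯`, `ι = (E♯ ⊂ ℂ)` of
`IsArtinCorrespondent.finiteIdeleRelNorm`. [cite: Milne2005ShimuraVarieties, (59) p. 107]
[cite: Shimura1998, §18.3 pp. 121–122] [cite: CasselsFrohlichANT1967, Ch. VII §4 Prop. 4.3] -/
theorem isArtinCorrespondent_finiteIdeleRelNorm
    (L : Type) [Field L] [NumberField L] [IsCMField L] (Φ : CMType L) (τ : L →+* ℂ) :
    (haveI : NumberField ↥(Aux.reflexField L Φ τ) := Aux.numberField_reflexField L Φ τ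
     letI : Algebra L ↥(Aux.reflexField L Φ τ) := (Aux.toReflexField L Φ τ).toAlgebra
     ∀ (σ : ℂ ≃+* ℂ) (s : (FiniteAdeleRing (𝓞 ↥(Aux.reflexField L Φ τ)) ↥(Aux.reflexField L Φ τ))ˣ),
       UnitaryCanonicalModel.IsArtinCorrespondent ↥(Aux.reflexField L Φ τ)
           (algebraMap ↥(Aux.reflexField L Φ τ) ℂ) s σ →
         UnitaryCanonicalModel.IsArtinCorrespondent L τ (finiteIdeleRelNorm L ↥(Aux.reflexField L Φ τ) s) σ) := by
  intro σ s h
  haveI : NumberField ↥(reflexField L Φ τ) := numberField_reflexField L Φ τ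
  letI : Algebra L ↥(reflexField L Φ τ) := (toReflexField L Φ τ).toAlgebra
  exact h.finiteIdeleRelNorm fun x => rfl

end Aux

end UnitaryCanonicalModel

end Literature.AlgebraicGeometry.ShimuraVarieties

end
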